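import Literature.IUT.LogThetaLattice.GlobalPacketsLGPMonoidsOfGaussianArch
import Literature.IUT.LogThetaLattice.VerticallyCoricLGPKummerTransport
import HarnessLib

/-!
# [IUTchIII] Proposition 3.5 (i) "for `v ∈ 𝕍`": the construction GENERIC in the carriers (`VerticallyCoricLGPData.ofPush`,
# naturality of gen 4's `LGPMonoidSignature.ofPush`) and at the ARCHIMEDEAN places (`VerticallyCoricLGPData.ofKummerArch`,
# over the Hermitian packets)

S. Mochizuki, *Inter-universal Teichmüller theory III*, kurims manuscript (May 2020) `paper:url-4b091feeb646`, §3,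
Proposition 3.5 (i) p. 103 l. 35 – p. 104 l. 28 (PRIMS offset ≈ +420) [claim: Mochizuki2012, status: disputed] for every
quoted sentence; abc-iut cell, layer L6, seat abc-iut-L6-t4 (typer of record of [IUTchIII] §3; gen 5). Third file of the
Prop. 3.5 (i) construction: `VerticallyCoricLGPKummer.lean` (p432850, the nonarchimedean fibre `{v ∣ p}` over the genuine
`p`-adic packets) and `VerticallyCoricLGPKummerTransport.lean` (transported data, no hypothesis) cover `v ∈ 𝕍^non`; print says
"for `v ∈ 𝕍`" (p. 104 l. 28) and "equipped with actions by topological groups when `v ∈ 𝕍^non`" — so at `v ∈ 𝕍^arc` the Kummer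
isomorphisms carry no group action and (archimedean places are never bad, [IUTchI] Def. 3.1 (b),(c)) no splitting.

WHAT IS BUILT.
* §1 GENERIC: `map_pushComponent_congr` — gen 4's component-push `pushComponent f v S j = f_{v,j}(pr_j S)` (the generic form
  of the Prop. 3.4 (ii) construction, `LGPMonoidSignature.ofPush`, p424447) is NATURAL in a Kummer isomorphism of labeled data
  `κ_v : Mm_v ≃* M_v` and multiplicative identifications `Φ_{v,j}` of the carriers intertwining the pushes
  (`Φ ∘ fm = f ∘ κ`); `ofPush_Ψ/ΨInf/ΨSplit/ΨGal_map_congr`; **`VerticallyCoricLGPData.ofPush`** — Prop. 3.5 (i) over ANY carriers: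
  étale-like output := `ofPush` at the coric data, Frobenius-like := `ofPush` at the index-`m` data, Kummer isomorphisms := the
  `Φ` restricted — the shape of `VerticallyCoricLGPData.ofKummer` (p432850: `ofGaussian = ofPush` at `lgpPush`, gen 4's
  `ofGaussian_eq_ofPush`; `Φ` = the packet transports `lgpPacketCongr`), now over arbitrary carriers.
* §2 ARCHIMEDEAN: `archLgpPacketCongr e v j` — the transport of gen 4's Hermitian label-`j` packets `ArchLGPPacket v j =
  ℂ_v ⊗_ℝ (⊗_{β≠j} ⊕_w ℂ_w)` induced by identifications `e_w : ℂ ≃ₐ[ℝ] ℂ` of the archimedean local fields of two 𝓕-prime-strips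
  (p432850's `PacketAt.congrAlg` over `ℝ`), natural for `toArchLGPPacket`; **`VerticallyCoricLGPData.ofKummerArch`** := `ofPush`
  at gen 4's archimedean pushes `toArchLGPPacket ∘ ι` — étale-like output = `LGPMonoidSignature.ofGaussianArch` at the coric data
  (`ofKummerArch_Ψcoric`, `rfl`), Frobenius-like = `ofGaussianArch` at index `m` (`ofKummerArch_ΨF`, `rfl`), Kummer isomorphism
  = the Hermitian-packet transport restricted (`ofKummerArch_kummer_coe`, `rfl`); the hypothesis-free instance
  **`VerticallyCoricLGPData.ofKummerArchTransport'`** (transported Gaussian data `kummerTransport`, compatible member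
  `e⁻¹ ∘ ι ∘ κ`).

HONEST SCOPE: as in the two parent files — topologies and the `F^{⋊±}_l`-symmetry compatibility are not modelled; the inputs
(`κ`, `e`, the coric archimedean Gaussian data of [IUTchII] Prop. 4.4 (iv) / Cor. 4.6 (iv) = abc-iut-L6-t2 SLOTS) stay abstract
submonoids and explicit members, exactly as in gen 4's `ofGaussianArch`; the two fibres remain separate `VerticallyCoricLGPData`
(a sigma-type repackaging over all of `𝕍` is bookkeeping, not done). No `Prop`-valued definition, no instance, no named fact;
nothing here asserts abc proved or refuted or takes a side on [IUTchIII] Cor. 3.12; constructed-as-junction ≠ upstream nodes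
discharged.
-/

noncomputable section

namespace Literature.IUT.LogThetaLattice

open scoped TensorProduct
open PiTensorProduct
open Literature.IUT.HodgeArakelov

universe u v' w' w''

/-! ### 1. Prop. 3.5 (i) GENERIC in the carriers: naturality of `LGPMonoidSignature.ofPush` -/

section GenericPush

variable {lstar : ℕ} {V : Type v'} (isBad : V → Prop)
/- coric carriers and `𝓘^ℚ` -/
variable (R : V → Fin lstar → Type u) [∀ v j, CommRing (R v j)] [∀ v j, Algebra ℚ (R v j)]
variable (IQ : ∀ v j, Submodule ℚ (R v j))
/- Frobenius-like carriers at each vertical index `m` -/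
variable (Rm : ℤ → V → Fin lstar → Type u) [∀ m v j, CommRing (Rm m v j)] [∀ m v j, Algebra ℚ (Rm m v j)]
variable (IQm : ∀ m v j, Submodule ℚ (Rm m v j))
/- coric labeled monoid data, pushes, Gaussian data -/
variable (M : V → Type w') [∀ v, CommMonoid (M v)]
variable (Γ : V → Type w'') [∀ v, Monoid (Γ v)] [∀ v, MulDistribMulAction (Γ v) (M v)]
variable (f : ∀ v (j : Fin lstar), M v →* R v j)
variable (gau gauInf : ∀ v, Submonoid (Fin lstar → M v)) (split : ∀ v, isBad v → Submonoid (Fin lstar → M v))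
/- Frobenius-like labeled monoid data at each `m` -/
variable (Mm : ℤ → V → Type w') [∀ m v, CommMonoid (Mm m v)] [∀ m v, MulDistribMulAction (Γ v) (Mm m v)]
variable (fm : ∀ m v (j : Fin lstar), Mm m v →* Rm m v j)
variable (gaum gauInfm : ∀ m v, Submonoid (Fin lstar → Mm m v))
variable (splitm : ∀ m v, isBad v → Submonoid (Fin lstar → Mm m v))
/- Kummer isomorphisms of labeled data and the carrier identifications they induce -/
variable (κ : ∀ m v, Mm m v ≃* M v) (Φ : ∀ m v (j : Fin lstar), Rm m v j ≃* R v j)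

omit [∀ v j, Algebra ℚ (R v j)] [∀ m v j, Algebra ℚ (Rm m v j)] [∀ v, MulDistribMulAction (Γ v) (M v)]
  [∀ m v, MulDistribMulAction (Γ v) (Mm m v)] in
/-- **Naturality of the generic Prop. 3.4 (ii) construction** (gen 4's `pushComponent`): for carrier identifications
`Φ_{v,j}` intertwining the pushes along a Kummer isomorphism of labeled data `κ_v` (`Φ ∘ fm = f ∘ κ`), `Φ_{v,j}` carries
`fm_{v,j}(pr_j S)` ONTO `f_{v,j}(pr_j κ(S))`. PROVED. [cite: Mochizuki2012, Prop. 3.5 (i) p.104] [claim: Mochizuki2012, status: disputed] -/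
theorem map_pushComponent_congr (m : ℤ) (hcompat : ∀ v j x, Φ m v j (fm m v j x) = f v j (κ m v x)) (v : V)
    (S : Submonoid (Fin lstar → Mm m v)) (j : Fin lstar) :
    (pushComponent (Rm m) (Mm m) (fm m) v S j).map (Φ m v j) =
      pushComponent R M f v (S.map (piIso (Fin lstar) (κ m v)).toMonoidHom) j := by
  ext y
  simp only [Submonoid.mem_map, mem_pushComponent_iff]
  constructor
  · rintro ⟨z, ⟨x, hx, rfl⟩, rfl⟩
    exact ⟨piIso (Fin lstar) (κ m v) x, ⟨x, hx, rfl⟩, (hcompat v j (x j)).symm⟩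
  · rintro ⟨_, ⟨x, hx, rfl⟩, rfl⟩
    exact ⟨fm m v j (x j), ⟨x, hx, rfl⟩, hcompat v j (x j)⟩

variable (hIQ : ∀ v j, IQ v j = ⊤) (split_le : ∀ v (h : isBad v), split v h ≤ gau v)
variable (hIQm : ∀ m v j, IQm m v j = ⊤) (splitm_le : ∀ m v (h : isBad v), splitm m v h ≤ gaum m v)

/-- The carrier identification carries `Ψ_{𝓕_LGP}(^{n,m})_{v,j}` (`ofPush` at index `m`) ONTO `Ψ_LGP(^{n,∘})_{v,j}` (`ofPush` at the
coric data) whenever `κ` carries the Gaussian monoid at `m` onto the coric one. [cite: Mochizuki2012, Prop. 3.5 (i) p.104]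
[claim: Mochizuki2012, status: disputed] -/
theorem ofPush_Ψ_map_congr (m : ℤ) (hcompat : ∀ v j x, Φ m v j (fm m v j x) = f v j (κ m v x))
    (hgau : ∀ v, (gaum m v).map (piIso (Fin lstar) (κ m v)).toMonoidHom = gau v) (v : V) (j : Fin lstar) :
    ((LGPMonoidSignature.ofPush isBad (Rm m) (IQm m) (Mm m) Γ (fm m) (gaum m) (gauInfm m) (splitm m) (hIQm m)
        (splitm_le m)).Ψ v j).map (Φ m v j) =
      (LGPMonoidSignature.ofPush isBad R IQ M Γ f gau gauInf split hIQ split_le).Ψ v j := by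
  change (pushComponent (Rm m) (Mm m) (fm m) v (gaum m v) j).map _ = pushComponent R M f v (gau v) j
  rw [map_pushComponent_congr R Rm M f Mm fm κ Φ m hcompat, hgau]

/-- `∞`-version. [cite: Mochizuki2012, Prop. 3.5 (i) p.104] [claim: Mochizuki2012, status: disputed] -/
theorem ofPush_ΨInf_map_congr (m : ℤ) (hcompat : ∀ v j x, Φ m v j (fm m v j x) = f v j (κ m v x))
    (hgauInf : ∀ v, (gauInfm m v).map (piIso (Fin lstar) (κ m v)).toMonoidHom = gauInf v) (v : V) (j : Fin lstar) :
    ((LGPMonoidSignature.ofPush isBad (Rm m) (IQm m) (Mm m) Γ (fm m) (gaum m) (gauInfm m) (splitm m) (hIQm m)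
        (splitm_le m)).ΨInf v j).map (Φ m v j) =
      (LGPMonoidSignature.ofPush isBad R IQ M Γ f gau gauInf split hIQ split_le).ΨInf v j := by
  change (pushComponent (Rm m) (Mm m) (fm m) v (gauInfm m v) j).map _ = pushComponent R M f v (gauInf v) j
  rw [map_pushComponent_congr R Rm M f Mm fm κ Φ m hcompat, hgauInf]

/-- Splittings correspond (bad `v`). [cite: Mochizuki2012, Prop. 3.5 (i) p.104] [claim: Mochizuki2012, status: disputed] -/
theorem ofPush_ΨSplit_map_congr (m : ℤ) (hcompat : ∀ v j x, Φ m v j (fm m v j x) = f v j (κ m v x)) {v : V}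
    (h : isBad v) (hsplit : (splitm m v h).map (piIso (Fin lstar) (κ m v)).toMonoidHom = split v h) (j : Fin lstar) :
    ((LGPMonoidSignature.ofPush isBad (Rm m) (IQm m) (Mm m) Γ (fm m) (gaum m) (gauInfm m) (splitm m) (hIQm m)
        (splitm_le m)).ΨSplit v h j).map (Φ m v j) =
      (LGPMonoidSignature.ofPush isBad R IQ M Γ f gau gauInf split hIQ split_le).ΨSplit v h j := by
  change (pushComponent (Rm m) (Mm m) (fm m) v (splitm m v h) j).map _ = pushComponent R M f v (split v h) j
  rw [map_pushComponent_congr R Rm M f Mm fm κ Φ m hcompat, hsplit]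

/-- Galois-invariant parts correspond for a `G_v`-equivariant `κ` (p432850's companion `map_piIso_galFixed`).
[cite: Mochizuki2012, Prop. 3.5 (i) p.104] [claim: Mochizuki2012, status: disputed] -/
theorem ofPush_ΨGal_map_congr (m : ℤ) (hcompat : ∀ v j x, Φ m v j (fm m v j x) = f v j (κ m v x))
    (hgau : ∀ v, (gaum m v).map (piIso (Fin lstar) (κ m v)).toMonoidHom = gau v)
    (hκΓ : ∀ v (g : Γ v) (x : Mm m v), κ m v (g • x) = g • κ m v x) (v : V) (j : Fin lstar) :
    ((LGPMonoidSignature.ofPush isBad (Rm m) (IQm m) (Mm m) Γ (fm m) (gaum m) (gauInfm m) (splitm m) (hIQm m)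
        (splitm_le m)).ΨGal v j).map (Φ m v j) =
      (LGPMonoidSignature.ofPush isBad R IQ M Γ f gau gauInf split hIQ split_le).ΨGal v j := by
  change (pushComponent (Rm m) (Mm m) (fm m) v (gaum m v ⊓ galFixed (Mm m) Γ v) j).map _ =
    pushComponent R M f v (gau v ⊓ galFixed M Γ v) j
  rw [map_pushComponent_congr R Rm M f Mm fm κ Φ m hcompat,
    Submonoid.map_inf _ _ (piIso (Fin lstar) (κ m v)).toMonoidHom (piIso (Fin lstar) (κ m v)).injective, hgau,
    map_piIso_galFixed M Γ Mm κ m v (hκΓ v)]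

/-- **[IUTchIII] Prop. 3.5 (i) GENERIC in the carriers — `VerticallyCoricLGPData.ofPush`**: étale-like (vertically coric) output :=
gen 4's `LGPMonoidSignature.ofPush` at the coric data, Frobenius-like at `m` := `ofPush` at the index-`m` data, Kummer
isomorphisms := the carrier identifications `Φ m` RESTRICTED (`ofPush_Ψ_map_congr`); coric splitting at bad `v`. The
`p`-adic construction `VerticallyCoricLGPData.ofKummer` (p432850) has exactly this shape at gen 4's `lgpPush` / the packet
transports `lgpPacketCongr`; the archimedean one below is literally an instance. [cite: Mochizuki2012, Prop. 3.5 (i) p.103] [claim: Mochizuki2012, status: disputed] -/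
def VerticallyCoricLGPData.ofPush (hcompat : ∀ m v j x, Φ m v j (fm m v j x) = f v j (κ m v x))
    (hgau : ∀ m v, (gaum m v).map (piIso (Fin lstar) (κ m v)).toMonoidHom = gau v)
    (hgauInf : ∀ m v, (gauInfm m v).map (piIso (Fin lstar) (κ m v)).toMonoidHom = gauInf v) :
    VerticallyCoricLGPData lstar V isBad R Rm where
  Ψcoric v j := (LGPMonoidSignature.ofPush isBad R IQ M Γ f gau gauInf split hIQ split_le).Ψ v j
  ΨcoricInf v j := (LGPMonoidSignature.ofPush isBad R IQ M Γ f gau gauInf split hIQ split_le).ΨInf v j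
  ΨF m v j := (LGPMonoidSignature.ofPush isBad (Rm m) (IQm m) (Mm m) Γ (fm m) (gaum m) (gauInfm m) (splitm m)
    (hIQm m) (splitm_le m)).Ψ v j
  ΨFInf m v j := (LGPMonoidSignature.ofPush isBad (Rm m) (IQm m) (Mm m) Γ (fm m) (gaum m) (gauInfm m) (splitm m)
    (hIQm m) (splitm_le m)).ΨInf v j
  kummer m v j := ((Φ m v j).submonoidMap _).trans (MulEquiv.submonoidCongr
    (ofPush_Ψ_map_congr isBad R IQ Rm IQm M Γ f gau gauInf split Mm fm gaum gauInfm splitm κ Φ hIQ split_le hIQm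
      splitm_le m (hcompat m) (hgau m) v j))
  kummerInf m v j := ((Φ m v j).submonoidMap _).trans (MulEquiv.submonoidCongr
    (ofPush_ΨInf_map_congr isBad R IQ Rm IQm M Γ f gau gauInf split Mm fm gaum gauInfm splitm κ Φ hIQ split_le hIQm
      splitm_le m (hcompat m) (hgauInf m) v j))
  ΨcoricSplit v h j := (LGPMonoidSignature.ofPush isBad R IQ M Γ f gau gauInf split hIQ split_le).ΨSplit v h j
  coricSplit_le v h j := (LGPMonoidSignature.ofPush isBad R IQ M Γ f gau gauInf split hIQ split_le).split_le v h j

/-- The generic Kummer isomorphism IS the carrier identification restricted. `rfl`. [cite: Mochizuki2012, Prop. 3.5 (i) p.104]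
[claim: Mochizuki2012, status: disputed] -/
theorem VerticallyCoricLGPData.ofPush_kummer_coe (hcompat : ∀ m v j x, Φ m v j (fm m v j x) = f v j (κ m v x))
    (hgau : ∀ m v, (gaum m v).map (piIso (Fin lstar) (κ m v)).toMonoidHom = gau v)
    (hgauInf : ∀ m v, (gauInfm m v).map (piIso (Fin lstar) (κ m v)).toMonoidHom = gauInf v)
    (m : ℤ) (v : V) (j : Fin lstar)
    (x : (VerticallyCoricLGPData.ofPush isBad R IQ Rm IQm M Γ f gau gauInf split Mm fm gaum gauInfm splitm κ Φ hIQ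
      split_le hIQm splitm_le hcompat hgau hgauInf).ΨF m v j) :
    ((VerticallyCoricLGPData.ofPush isBad R IQ Rm IQm M Γ f gau gauInf split Mm fm gaum gauInfm splitm κ Φ hIQ
        split_le hIQm splitm_le hcompat hgau hgauInf).kummer m v j x : R v j) = Φ m v j (x : Rm m v j) := rfl

end GenericPush

/-! ### 2. Prop. 3.5 (i) at the ARCHIMEDEAN places, over gen 4's Hermitian label-`j` packets -/

section Arch

variable {Varc : Type} [Fintype Varc] {lstar : ℕ} (isBad : Varc → Prop)

/-- The transport `log(^{S^±_{j+1},j}𝔉'_v) ⥲ log(^{S^±_{j+1},j}𝔉_v)` of the archimedean label-`j` packets `ArchLGPPacket v j =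
ℂ_v ⊗_ℝ (⊗_{β≠j} ⊕_w ℂ_w)` (gen 4) induced by identifications `e_w : ℂ ≃ₐ[ℝ] ℂ` of the archimedean local fields of two
𝓕-prime-strips ("the evident identification", p. 104 l. 15; p432850's `PacketAt.congrAlg` over `ℝ`).
[cite: Mochizuki2012, Prop. 3.5 (i) p.104] [claim: Mochizuki2012, status: disputed] -/
def archLgpPacketCongr (e : Varc → (ℂ ≃ₐ[ℝ] ℂ)) (v : Varc) (j : Fin lstar) : ArchLGPPacket v j ≃ₐ[ℝ] ArchLGPPacket v j :=
  PacketAt.congrAlg ℝ (ArchComponents (Fin (labelNat j + 1)) Varc) (ArchComponents (Fin (labelNat j + 1)) Varc)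
    (fun _ w => e w) (Fin.last (labelNat j)) v

omit [Fintype Varc] in
/-- Naturality for `toArchLGPPacket` ("tensor with 1's"): the transport restricts on `ℂ_v` to `e_v`.
[cite: Mochizuki2012, Prop. 3.5 (i) p.104] [claim: Mochizuki2012, status: disputed] -/
theorem archLgpPacketCongr_toArchLGPPacket (e : Varc → (ℂ ≃ₐ[ℝ] ℂ)) (v : Varc) (j : Fin lstar) (z : ℂ) :
    archLgpPacketCongr e v j (toArchLGPPacket v j z) = toArchLGPPacket v j (e v z) :=
  PacketAt.congrAlg_toPacketAt ℝ (ArchComponents (Fin (labelNat j + 1)) Varc)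
    (ArchComponents (Fin (labelNat j + 1)) Varc) (fun _ w => e w) (Fin.last (labelNat j)) v z

variable (M : Varc → Type w') [∀ v, CommMonoid (M v)]
variable (Γ : Varc → Type w'') [∀ v, Monoid (Γ v)] [∀ v, MulDistribMulAction (Γ v) (M v)]
variable (ι : ∀ v, M v →* ℂ)
variable (gau gauInf : ∀ v, Submonoid (Fin lstar → M v)) (split : ∀ v, isBad v → Submonoid (Fin lstar → M v))
variable (split_le : ∀ v (h : isBad v), split v h ≤ gau v)
variable (Mm : ℤ → Varc → Type w') [∀ m v, CommMonoid (Mm m v)] [∀ m v, MulDistribMulAction (Γ v) (Mm m v)]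
variable (ιm : ∀ m v, Mm m v →* ℂ)
variable (gaum gauInfm : ∀ m v, Submonoid (Fin lstar → Mm m v))
variable (splitm : ∀ m v, isBad v → Submonoid (Fin lstar → Mm m v))
variable (splitm_le : ∀ m v (h : isBad v), splitm m v h ≤ gaum m v)
variable (κ : ∀ m v, Mm m v ≃* M v) (e : ℤ → Varc → (ℂ ≃ₐ[ℝ] ℂ))
variable {r : ℝ} (hr : r ≠ 0)

omit [Fintype Varc] [∀ v, MulDistribMulAction (Γ v) (M v)] [∀ m v, MulDistribMulAction (Γ v) (Mm m v)] in
/-- Compatible members intertwine gen 4's archimedean pushes `toArchLGPPacket ∘ ι`. [cite: Mochizuki2012, Prop. 3.5 (i) p.104]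
[claim: Mochizuki2012, status: disputed] -/
theorem archLgpPacketCongr_push (hcompat : ∀ m v x, e m v (ιm m v x) = ι v (κ m v x)) (m : ℤ) (v : Varc)
    (j : Fin lstar) (x : Mm m v) :
    (archLgpPacketCongr (e m) v j).toMulEquiv (((toArchLGPPacket v j).comp (ιm m v)) x) =
      ((toArchLGPPacket v j).comp (ι v)) (κ m v x) := by
  change archLgpPacketCongr (e m) v j (toArchLGPPacket v j (ιm m v x)) = toArchLGPPacket v j (ι v (κ m v x))
  rw [archLgpPacketCongr_toArchLGPPacket, hcompat]

/-- **[IUTchIII] Prop. 3.5 (i) CONSTRUCTED AT THE ARCHIMEDEAN PLACES — `VerticallyCoricLGPData.ofKummerArch`**: `ofPush` at the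
Hermitian packets (`𝓘^ℚ` = the `ℚ`-span of the Hermitian unit ball of radius `r ≠ 0`, everything: `archLgpShellQ_eq_top`), the
archimedean pushes `toArchLGPPacket ∘ ι` (coric) / `toArchLGPPacket ∘ ι_m` (index `m`) and the Hermitian-packet transports
`archLgpPacketCongr (e m)`; the Kummer isomorphisms at `v ∈ 𝕍^arc` ("for `v ∈ 𝕍`", p. 104 l. 28) = these transports restricted.
[cite: Mochizuki2012, Prop. 3.5 (i) p.103] [claim: Mochizuki2012, status: disputed] -/
def VerticallyCoricLGPData.ofKummerArch (hcompat : ∀ m v x, e m v (ιm m v x) = ι v (κ m v x))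
    (hgau : ∀ m v, (gaum m v).map (piIso (Fin lstar) (κ m v)).toMonoidHom = gau v)
    (hgauInf : ∀ m v, (gauInfm m v).map (piIso (Fin lstar) (κ m v)).toMonoidHom = gauInf v) :
    VerticallyCoricLGPData lstar Varc isBad (fun v j => ArchLGPPacket v j) (fun _ v j => ArchLGPPacket v j) :=
  VerticallyCoricLGPData.ofPush isBad (fun v j => ArchLGPPacket v j) (fun v j => archLgpShellQ r v j)
    (fun _ v j => ArchLGPPacket v j) (fun _ v j => archLgpShellQ r v j) M Γ (fun v j => (toArchLGPPacket v j).comp (ι v))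
    gau gauInf split Mm (fun m v j => (toArchLGPPacket v j).comp (ιm m v)) gaum gauInfm splitm κ
    (fun m v j => (archLgpPacketCongr (e m) v j).toMulEquiv) (fun v j => archLgpShellQ_eq_top hr v j) split_le
    (fun _ v j => archLgpShellQ_eq_top hr v j) splitm_le
    (fun m v j x => archLgpPacketCongr_push M ι Mm ιm κ e hcompat m v j x) hgau hgauInf

variable (hcompat : ∀ m v x, e m v (ιm m v x) = ι v (κ m v x))
    (hgau : ∀ m v, (gaum m v).map (piIso (Fin lstar) (κ m v)).toMonoidHom = gau v)
    (hgauInf : ∀ m v, (gauInfm m v).map (piIso (Fin lstar) (κ m v)).toMonoidHom = gauInf v)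

/-- Vertically coric at `v ∈ 𝕍^arc`: the étale-like output IS gen 4's `LGPMonoidSignature.ofGaussianArch` at the coric data. `rfl`.
[cite: Mochizuki2012, Prop. 3.5 (i) p.104] [claim: Mochizuki2012, status: disputed] -/
theorem VerticallyCoricLGPData.ofKummerArch_Ψcoric (v : Varc) (j : Fin lstar) :
    (VerticallyCoricLGPData.ofKummerArch isBad M Γ ι gau gauInf split split_le Mm ιm gaum gauInfm splitm splitm_le κ e hr
        hcompat hgau hgauInf).Ψcoric v j =
      (LGPMonoidSignature.ofGaussianArch isBad M Γ ι gau gauInf split hr split_le).Ψ v j := rfl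

/-- "compatible … with the functorial algorithm of Proposition 3.4, (ii)" at `v ∈ 𝕍^arc`: the Frobenius-like monoid at `m` IS
`ofGaussianArch` at the index-`m` data. `rfl`. [cite: Mochizuki2012, Prop. 3.5 (i) p.104] [claim: Mochizuki2012, status: disputed] -/
theorem VerticallyCoricLGPData.ofKummerArch_ΨF (m : ℤ) (v : Varc) (j : Fin lstar) :
    (VerticallyCoricLGPData.ofKummerArch isBad M Γ ι gau gauInf split split_le Mm ιm gaum gauInfm splitm splitm_le κ e hr
        hcompat hgau hgauInf).ΨF m v j =
      (LGPMonoidSignature.ofGaussianArch isBad (Mm m) Γ (ιm m) (gaum m) (gauInfm m) (splitm m) hr (splitm_le m)).Ψ v j :=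
  rfl

/-- The archimedean Kummer isomorphism IS the Hermitian-packet transport restricted. `rfl`. [cite: Mochizuki2012, Prop. 3.5 (i) p.104]
[claim: Mochizuki2012, status: disputed] -/
theorem VerticallyCoricLGPData.ofKummerArch_kummer_coe (m : ℤ) (v : Varc) (j : Fin lstar)
    (x : (VerticallyCoricLGPData.ofKummerArch isBad M Γ ι gau gauInf split split_le Mm ιm gaum gauInfm splitm splitm_le κ e
      hr hcompat hgau hgauInf).ΨF m v j) :
    ((VerticallyCoricLGPData.ofKummerArch isBad M Γ ι gau gauInf split split_le Mm ιm gaum gauInfm splitm splitm_le κ e hr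
        hcompat hgau hgauInf).kummer m v j x : ArchLGPPacket v j) = archLgpPacketCongr (e m) v j (x : ArchLGPPacket v j) :=
  rfl

omit [Fintype Varc] [∀ v, MulDistribMulAction (Γ v) (M v)] [∀ m v, MulDistribMulAction (Γ v) (Mm m v)] in
/-- The compatible archimedean member `ι_m := e_m⁻¹ ∘ ι ∘ κ_m` is compatible. [cite: Mochizuki2012, Prop. 3.5 (i) p.103]
[claim: Mochizuki2012, status: disputed] -/
theorem archKummerMember_compat (m : ℤ) (v : Varc) (x : Mm m v) :
    e m v ((((e m v).symm : ℂ ≃ₐ[ℝ] ℂ) : ℂ →* ℂ).comp ((ι v).comp (κ m v).toMonoidHom) x) = ι v (κ m v x) :=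
  (e m v).apply_symm_apply _

/-- **Prop. 3.5 (i) at `v ∈ 𝕍^arc` with NO hypothesis**: transported Gaussian data (p432850's companion `kummerTransport`) and the
compatible member `e⁻¹ ∘ ι ∘ κ`. [cite: Mochizuki2012, Prop. 3.5 (i) p.103] [claim: Mochizuki2012, status: disputed] -/
def VerticallyCoricLGPData.ofKummerArchTransport' :
    VerticallyCoricLGPData lstar Varc isBad (fun v j => ArchLGPPacket v j) (fun _ v j => ArchLGPPacket v j) :=
  VerticallyCoricLGPData.ofKummerArch isBad M Γ ι gau gauInf split split_le Mm
    (fun m v => (((e m v).symm : ℂ ≃ₐ[ℝ] ℂ) : ℂ →* ℂ).comp ((ι v).comp (κ m v).toMonoidHom))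
    (fun m v => kummerTransport M Mm κ m v (gau v)) (fun m v => kummerTransport M Mm κ m v (gauInf v))
    (fun m v h => kummerTransport M Mm κ m v (split v h)) (fun m v h => kummerTransport_mono M Mm κ m v (split_le v h))
    κ e hr (archKummerMember_compat M ι Mm κ e) (fun m v => map_kummerTransport M Mm κ m v (gau v))
    (fun m v => map_kummerTransport M Mm κ m v (gauInf v))

end Arch

end Literature.IUT.LogThetaLattice

end
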